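import Literature.MathematicalPhysics.QuantumFieldTheory.ConformalBootstrap3D.PointKernelK34v2Data

/-!
# K34v2 certificate, kernel block file H18: head segments `274 ≤ i < 280` (block-checked ones)

`decide` by kernel reduction (no `native_decide`, no extra axioms) of the block checker
`PCert.hBlockOK` of `PointKernel` on the literal data of `PointKernelK34v2Data` (cells checked corner
or chord by the rule bit); soundness is `PCert.hBlockOK_sound`.  Estimated kernel time 213 s
(4 theorems).
-/

set_option maxRecDepth 100000
set_option maxHeartbeats 0

namespace Literature.MathematicalPhysics.QuantumFieldTheory.ConformalBootstrap3D.PointKernelK34v2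

open Literature.MathematicalPhysics.QuantumFieldTheory.ConformalBootstrap3D.PointKernel

/-- head segment `[274, 275)` passes the kernel evaluator (≈42 s of kernel work). [folklore] -/
theorem hBlock_274 : certK34v2.hBlockOK hsegsK34v2 274 275 JHK34v2 = true := by
  decide +kernel

/-- head segment `[275, 276)` passes the kernel evaluator (≈34 s of kernel work). [folklore] -/
theorem hBlock_275 : certK34v2.hBlockOK hsegsK34v2 275 276 JHK34v2 = true := by
  decide +kernel

/-- head segment `[276, 277)` passes the kernel evaluator (≈39 s of kernel work). [folklore] -/
theorem hBlock_276 : certK34v2.hBlockOK hsegsK34v2 276 277 JHK34v2 = true := by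
  decide +kernel

/-- head segments `[277, 280)` pass the kernel evaluator (≈38 s of kernel work). [folklore] -/
theorem hBlock_277 : certK34v2.hBlockOK hsegsK34v2 277 280 JHK34v2 = true := by
  decide +kernel

end Literature.MathematicalPhysics.QuantumFieldTheory.ConformalBootstrap3D.PointKernelK34v2
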